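import Mathlib
import HarnessLib
import HarnessLib.Audit
import Summits.CriticalPhenomena.Statement

/-!
Route: PercLayerChain

DORMANT since 2026-09-03T10:53:30Z (reconciler: no traction for 5 d (last activity statement-checked at 2026-08-29T10:21:03Z); parked, not closed — `ledger route dormant route-CriticalPhenomena-PercLayerChain --off` to reactivate) — unstaffed, not closed; items shared with open routes are served there. `ledger route dormant <id> --off` reactivates.

# Route PercLayerChain — layer-chain shadow calculus — θ(p_c)=0 iff deep points lose the wall;
section-ratio moments, reciprocity, lineage hazard

It suffices to show X = ShadowDensityVanishes: at p = p_c(ℤ³), with H = {x ∈ ℤ³ | x₀ ≥ 0} (tree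
convention), floor ∂H = {x₀ = 0}
and y_t = (t,0,0), the SHADOW DENSITY s_t := P_{p_c}(y_t ↔ ∂H inside H) tends to 0 as t → ∞. This
realises card
layer-chain-coalescence: by the vertical shift y_t ↦ 0, s_t = P(the tagged lineage [0]_t of the
layer chain is alive at step t),
s_t is non-increasing and s_t ↓ θ(p_c) exactly (Barsky–Grimmett–Newman, PROVED in tree), so X ⟺ "the
tagged lineage dies a.s."
⟺ the card's tightness criterion ⟺ the conjunct; moreover θ_t/6 ≤ s_t ≤ θ_t (θ_t = P(0 ↔ ∂Λ_t);
square-root trick, card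
halfspace-box-trace-facts (F2)), so X is the bulk one-arm decay read through the wall. The content
sits in three ranked sufficient
inequalities about the FINITE critical wall cluster C_H(0) and the chain's exact death law (r2–r4
below), each ⇒ X by provable glue.
Lean: `Filter.Tendsto (fun t : ℕ => (Literature.Probability.Percolation.bondPercolation
(Literature.Probability.LatticeModels.zdGraph 3) (Literature.Probability.Percolation.criticalProbI
3)).real {ω | ∃ w : Literature.Probability.LatticeModels.Site 3, w 0 = 0 ∧ ω ∈
Literature.Probability.Percolation.openConnIn {x : Literature.Probability.LatticeModels.Site 3 | 0 ≤
x 0} (Pi.single 0 (t : ℤ)) w}) Filter.atTop (nhds 0)`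

## Assembly
X → PercolationContinuityZ3 by either of two elementary reductions. (a) Square-root trick: the cube
y_t + Λ_t lies in H with a face on the
floor, {y_t ↔ its boundary inside it} has probability θ_t = P_{p_c}(0 ↔ ∂Λ_t) ≥ θ(p_c) and is the
union of six increasing face events
equivalent under lattice symmetries fixing y_t, so s_t ≥ P(y_t ↔ bottom face inside the cube) ≥ 1 −
(1 − θ_t)^{1/6} ≥ θ(p_c)/6 (card
halfspace-box-trace-facts (F2); FKG square-root trick as in SeedLemma.lean / CleanSeeds.lean). (b)
BGN: {0 ↔ ∞} ⊆ {0 ↔ {x₀ = −t} inside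
{x₀ ≥ −t}} ∪ {an infinite open cluster inside {x₀ ≥ −t+1}}, the second event is null
(BarskyGrimmettNewman1991_Z3_holds + translations +
theta_induce_eq_real_percolatesVia + lowest-level argument), and the first has probability s_t by
the vertical shift. Either way θ(p_c) ≤ 6·lim s_t = 0.
The engines feed X through the supports: SectionRatioMoment → ShadowReciprocity → X
(MomentGivesReciprocity, ReciprocitySuffices) and
LineageHazard → X (DeathLaw, HazardSuffices).

Rationale: WHY THIS LINE. The card's chain (partition of layer t by connectivity below t; stationary, Markov,
driven by fresh layers) has an EXACT death law,
P(lineage dies at t+1 | F_t) = (1−p_c)^{|[0]_t|}, and a footprint-normalised horizontal mass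
transport (LyonsPeres2016 §8; in-tree shift
lemmas of HalfSpacePinnedPairs.lean) gives the identity s_t = E[D_t/W], D_t = |C_H(0) ∩ {x₀ = t}|, W
= |C_H(0) ∩ ∂H| ≥ 1 (support
ShadowTransport): the bulk one-arm probability is, up to a factor 6, the expected SECTION RATIO of
the a.s.-finite critical wall cluster
(BarskyGrimmettNewman1991 = Grimmett1999 Thm (7.35),
Literature.Probability.Percolation.BarskyGrimmettNewman1991_Z3_holds). In a jump world
(θ(p_c) = θ* > 0) s_t ≥ θ* while π_t := P(C_H(0) reaches height t) → 0 (BGN), so E[(D_t/W)^q] ≥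
s_t^q π_t^{1−q} → ∞ for every q > 1 and the
lineage hazard h_t = 1 − s_{t+1}/s_t is summable — the card's "coalescing flow" made quantitative;
in reality (surface scaling, Cardy1996 ch. 7;
x_s ≈ 0.975 DengBlote2005, x_h = β/ν ≈ 0.48) E[(D_t/W)^q] ~ t^{q(x_s−x_h)−x_s} stays bounded for q <
x_s/(x_s−x_h) ≈ 1.9, s_t ≈ π_t^{0.49}, and
t·h_t → x_h. The cruxes are exactly these three dichotomies (r2 q-moment, r3 reciprocity, r4 hazard
≥ c/t); each implies X by Hölder /
BGN / the death law. The card's own engines were analysed and replaced: AntiFunnel is void (the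
death law gives Σ_t E[D_t; W = j] ≤
j(1−p_c)^{−j} for free, and small-block shadows are small in the jump world too), the
coalescence-rate bookkeeping needs rates that BGN and
Lévy do not supply. Imported areas: mass transport / re-rooting (LyonsPeres2016), moment
(reverse-Hölder) methods, surface critical
phenomena as the calibration dictionary (Cardy1996, DengBlote2005), Nolin2008 Thm 23 (half-plane
3-arm exponent 2 = d) as the 2-D model of the
hazard count; the d ≥ 11 analogue of r3 holds by KozmaNachmias2011 (one-arm n^{-2}) +
ChatterjeeHanson2020 (half-space one-arm n^{-3}).
Versus prior routes: PercLowPointHalfSpace bets on boundary two-arm / mass exponents (a₂ > 5/2, m ≤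
11/4); this route's functionals
(section ratio, the two directions of wall connection, the lineage hazard) are different statements
with jump-world negations forced by BGN.

RANKED CRUXES. #0 ShadowDensityVanishes (target) — X: s_t = P_{p_c}(y_t ↔ ∂H in H) → 0 as t → ∞
(deep points lose the wall; = the tagged lineage of the layer chain dies a.s.; card r2 in its honest
form). (why it might fail: equivalent to the conjunct (s_t ↓ θ(p_c) by BGN; θ_t/6 ≤ s_t ≤ θ_t): it
fails iff θ(p_c) > 0; filed as the frame every engine bounds, not as progress.)
[BarskyGrimmettNewman1991, Grimmett1999, DuminilCopinTassionCMP2016]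
#2 SectionRatioMoment (crux) — there are q > 1 and C with E_{p_c}[(D_t/W)^q] ≤ C for all t ≥ 1,
where D_t = |C_H(0) ∩ {x₀ = t}| and W = |C_H(0) ∩ {x₀ = 0}| are the height-t and floor sections of
the critical wall cluster of the origin (card: "exclude shadow amplification", corrected from the
conditional ratio — which diverges in reality too — to the q-th moment per wall point). [difficulty:
open-problem] (why it might fail: scaling gives E[(D_t/W)^q] ~ t^{q(x_s−x_h)−x_s}, bounded only for
q < x_s/(x_s−x_h) ≈ 1.9 (q = 2 already borderline); heavier conditional tails of D_t/W from tall
clusters hanging on few floor contacts (isolated-contact exponent < 3) would close the window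
entirely.) [DengBlote2005, Cardy1996, BarskyGrimmettNewman1991, LyonsPeres2016]
#3 ShadowReciprocity (crux) — there are a > 0 and C with s_t ≤ C · π_t^a for all t ≥ 1, where π_t =
P_{p_c}(C_H(0) meets {x₀ = t}) is the wall-to-height-t arm: the deep-to-wall connection is
polynomially controlled by the wall-to-deep connection (reality a ≤ x_h/x_s ≈ 0.49; jump world: s_t
≥ θ* while π_t → 0). [difficulty: open-problem] (why it might fail: beyond the union bound s_t ≤
E|C_H(0) ∩ {x₀=t}|·(…), which overshoots by t^{0.6}, no tool couples the two directions; the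
statement ties the bulk arm exponent to the surface one (a ≤ x_h/x_s) and is false in a jump world,
so a proof needs genuinely d = 3 input.) [BarskyGrimmettNewman1991, KozmaNitzan2024,
ChatterjeeHanson2020, KozmaNachmias2011, DengBlote2005]
#4 LineageHazard (crux) — there is c > 0 with P_{p_c}(y_t ↔ ∂H in H and every floor point so reached
has its edge to {x₀ = −1} closed) ≥ (c/t)·s_t for all t ≥ 1 — by the death law the left side is s_t
− s_{t+1}, so this says the tagged lineage's hazard is ≥ c/t (reality: t·h_t → x_h ≈ 0.48; jump
world: Σ_t h_t < ∞); it yields s_t ≤ C t^{−c}, a polynomial one-arm bound. [difficulty: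
open-problem] (why it might fail: c/t is the exact order (no slack): deep pieces hanging on O(log t)
floor contacts must have density ≍ t^{-3} per floor site, the 3-D analogue of the half-plane 3-arm
exponent 2 = d (Nolin2008 Thm 23); any o(t^{-3}) correction kills this form while X survives.)
[Nolin2008, Grimmett1999, BarskyGrimmettNewman1991, DuminilCopinTassionCMP2016]
#9 ShadowTransport (support) — footprint-normalised mass transport: for every t, s_t = E_{p_c}[D_t /
W] (send mass 1/W from each floor point of a wall cluster to each of its height-t points; horizontal
translation invariance bondPercolation_map_shift + shift_mem_openConnIn_iff; C_H(0) a.s. finite by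
BarskyGrimmettNewman1991_Z3_holds handles the conventions on the null set). [difficulty:
provable-now] [LyonsPeres2016, BarskyGrimmettNewman1991]
#9 DeathLaw (support) — the exact death law of the layer chain in fixed-H form: s_t − s_{t+1} =
P(y_t ↔ ∂H in H, and no floor point joined to y_t in H has an open edge to {x₀ = −1}) (vertical
shift by one layer + first-passage decomposition of a path at the floor; by independence of the
sub-floor edges the right side equals E[(1−p_c)^{|B_t|}; B_t ≠ ∅], B_t the floor block of y_t).
[difficulty: provable-now] [Grimmett1999, BarskyGrimmettNewman1991]
#9 MomentGivesReciprocity (support) — SectionRatioMoment → ShadowReciprocity with a = 1 − 1/q: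
Hölder on s_t = E[(D_t/W)·1{D_t ≥ 1}] (ShadowTransport) and π_t = P(D_t ≥ 1). [difficulty:
provable-now] [LyonsPeres2016, BarskyGrimmettNewman1991]
#9 ReciprocitySuffices (support) — ShadowReciprocity → ShadowDensityVanishes: π_t ↓ P(C_H(0)
infinite) = 0 (events decreasing in t; BarskyGrimmettNewman1991_Z3_holds via
theta_induce_eq_real_percolatesVia), hence s_t ≤ C π_t^a → 0. [difficulty: provable-now]
[BarskyGrimmettNewman1991, Grimmett1999]
#9 HazardSuffices (support) — LineageHazard → ShadowDensityVanishes: with DeathLaw, s_{t+1} ≤ (1 −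
c/t) s_t for t ≥ 1, so s_t ≤ s_1 ∏_{j<t}(1 − c/j) → 0. [difficulty: M] [Grimmett1999]
#9 TightnessCriterion (support) — the card's criterion: if the floor block B_t = {w ∈ ∂H : y_t ↔ w
in H} is tight uniformly in t (∀ε ∃m ∀t P(|B_t| ≥ m) ≤ ε, |·| = encard), then θ(p_c) = 0. Proof:
DeathLaw summed over t gives Σ_t E[(1−p_c)^{|B_t|}; 1 ≤ |B_t| < ∞] ≤ 1, so P(1 ≤ |B_t| ≤ m) → 0 for
each m; hence limsup s_t ≤ ε, i.e. X, then Assembly. [difficulty: M] [BarskyGrimmettNewman1991,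
Grimmett1999]

TWO-LAYER PLAN. Foreseen glued splits, none filed now: ShadowReciprocity ⇐ SectionRatioMoment →
MomentGivesReciprocity → ShadowReciprocity (already wired as
support); SectionRatioMoment ⇐ (wetting: W ≥ c·|T|-thinning of the top layer T of each sub-floor
cluster, a Binomial(|T|, p_c) comparison) →
(sub-floor section-ratio moment for clusters of {x₀ ≥ 1} rooted on {x₀ = 1}) → SectionRatioMoment;
LineageHazard ⇐ (thread lower bound:
P(1 ≤ |B_t| ≤ C log t) ≥ (c/t) s_t) → DeathLaw → LineageHazard. An all-p form of r3, θ(p) ≤ C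
θ_ℍ(p)^a for every p (⇒ conjunct by BGN in one
line; reality a ≈ β/β₁ ≈ 0.49), is the t = ∞ reading of ShadowReciprocity and would be filed as a
sibling crux only if a finite-volume,
p-uniform mechanism for r3 emerges.

KILL CRITERIA. No crux here can be refuted without refuting scaling numerics, but each has a cheap
numerical death: (i) Monte Carlo showing E[(D_t/W)^q]
growing in t for every q > 1 tested down to q = 1.2 kills SectionRatioMoment as stated (restate with
the true window or close); (ii) s_t/π_t^a
unbounded for all a ≥ 0.3 kills ShadowReciprocity; (iii) t·(1 − s_{t+1}/s_t) → 0 numerically kills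
LineageHazard. A proof elsewhere of
PercAnnulusCrossing.CritAnnulusNonCrossing gives θ_{2t} ≤ (1−c)θ_t by BK and hence X directly — the
route is then mooted (close superseded),
which is why the halving form s_{2t} ≤ (1−δ)s_t was NOT filed here. If all three engines die
numerically while X (numerically) holds, keep
ShadowTransport/DeathLaw/TightnessCriterion as Theorems and close the route as exhausted.

NOT DECOMPOSED YET. The wetting/thinning comparison behind r2 (floor contacts of a sub-floor cluster
dominate a p_c-thinning of its top layer); the thread
lower bound behind r4 (constructing deep clusters with O(log t) floor contacts at density ≥ t^{-3});
any use of the second tagged lineage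
(coalescence rate of two lineages at distance r, the card's r4: its bookkeeping needs a rate for
|[0]_t| → ∞ beyond Lévy's log t and a rate
for π_t → 0 beyond BGN, neither available — parked); the Markov-chain formalisation itself (state =
partition of a layer) is not needed by
any filed item, only the death law is.

CHEAPEST FALSIFIER. One Monte-Carlo run (kit, a few CPU-hours; not run by this planner seat): bond
percolation on ℤ³ at p = 0.2488126 in [0,2L]×[−L,L]², L = 96,
free top, measure for t = 4,6,8,12,16,24,32,48: s_t (fraction of height-t points joined to the floor
inside H), π_t (fraction of floor points
whose H-cluster reaches height t), the wall-rooted moments E[(D_t/W)^q] for q ∈ {1.2, 1.5, 2}, and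
t(1 − s_{t+1}/s_t). Predictions if the
line is sound: s_t ≈ c t^{-0.48}, π_t ≈ c' t^{-0.97}, log s_t / log π_t → ≈ 0.49, E[(D_t/W)^{1.5}]
flat or decreasing, E[(D_t/W)^2] ≈ flat
(borderline), t·h_t ≈ 0.45–0.5. Growth of the q = 1.5 moment or t·h_t drifting to 0 retires r2 resp.
r4 immediately.

NUMBERS. x_s (surface magnetic scaling dimension of 3-D percolation, ordinary transition) ≈
0.97–0.98, i.e. wall one-arm π_t ~ t^{-x_s} and wall
two-point ~ r^{-2x_s} (DengBlote2005, paper wanted: acq-01316; value as quoted in-tree by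
PercLowPointHalfSpace); x_h = β/ν ≈ 0.477, d_f =
3 − x_h ≈ 2.52 (bulk); hence given a tall wall cluster W ~ t^{2−x_s} ≈ t^{1.03}, D_t ~ t^{2−x_h} ≈
t^{1.52}, s_t ~ t^{-x_h}, amplification
D_t/W ~ t^{0.50}; moment window q < x_s/(x_s − x_h) ≈ 1.9–2.0; reciprocity exponent a ≤ x_h/x_s ≈
0.49; hazard constant c < x_h. Mean-field
check (d ≥ 11): one-arm n^{-2} (KozmaNachmias2011), half-space one-arm n^{-3} (ChatterjeeHanson2020)
⇒ r3 holds there with a = 2/3, r2 with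
q < 3, r4 with c < 2. 2-D model: half-plane 2-arm ≍ N^{-1}, 3-arm ≍ N^{-2} (Nolin2008 Thm 23). Items
at open: 11 (1 target, 3 cruxes, 6
support, 1 assembly).

DEFINITION REQUESTS. None needed: all statements are written over bondPercolation (zdGraph 3)
(criticalProbI 3), openConnIn {x | 0 ≤ x 0} (=
Literature.Probability.Percolation.halfSpace 3; halfSpaceCluster / halfSpaceFootprint of
HalfSpacePinnedPairs.lean are definitionally the
sets used), Set.ncard / Set.encard, lintegral. A Literature notion `floorBlock t ω` / `shadowDensity
t` would shorten the decls; optional.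

Novelty: Searches (2026-08-15): `lit search --hybrid "surface critical behavior three-dimensional percolation
ordinary transition boundary exponent"`
(12 book hits; Cardy1996 ch. 7 read, PDF p.124: x_{h,s}, r^{-2x_{h,s}} / r^{-x_{h,s}-x_h} decay, β₁
= x_{h,s}/y_t); `lit vsearch` "point at
distance t from the boundary connected to the boundary vs boundary point connected to distance t;
bulk vs surface one-arm" (10 generic
textbook hits, nothing specific); `lit search --source crossref "surface critical phenomena
three-dimensional percolation"` (7; DengBlote2005
doi:10.1103/physreve.71.016117 found, paywalled → acq-01316); `--source zbmath` (6, unrelated);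
OpenAlex/arXiv HTTP 429 (budget exhausted);
`lit frontier CriticalPhenomena --since 2021` (30 rows: nearest arXiv:2312.10030 arm exponents for
the metric-graph GFF in 3 ≤ d ≤ 6 and
arXiv:2602.12261 half-plane non-coexistence, planar; nothing on half-space shadows / layer chains);
`lit read arXiv:0711.4948` (Nolin2008 §5.2
Thm 23 and its counting proof read); `lit galaxy search … --star all|pdf` twice: galaxyd saturated
(> 90 s queue), not obtained — a refuter
should rerun "half-space percolation boundary bulk exponent inequality" and "layer transfer Markov
chain percolation threshold" there; the nine
Theses files and the neighbouring cards (halfspace-box-trace-facts, climb-ratio-receding-floor-v2,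
gamblers-ruin-vs-receding-floor,
lowpoint-identity-halfspace-pinned-pairs) read in full.
Nearest prior art found: BarskyGrimmettNewman1991  [refs: 10.1103/physreve.71.016117, 2312.10030, 2602.12261, 0711.4948, doi:10.1103/physreve.71.016117, Cardy1996, DengBlote2005, Nolin2008, BarskyGrimmettNewman1991, Grimmett1999, KozmaNachmias2011, ChatterjeeHanson2020]

Barriers (technique_class: half-space-layer-chain, mass-transport, moment-method): - technique_class: half-space-layer-chain, mass-transport, moment-method
- Literature.Barriers.CriticalPhenomena.SprinklingRenormalisation: evaded at the level of statements
— everything is at p = p_c inside H, no p + η ever occurs, and the only renormalisation input is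
BGN, the barrier's own listed evasion (steering needs no extra money in a half-space); conceded that
a proof of r3 by a Grimmett–Marstrand block construction moving sideways through explored territory
would meet it again — r3 must be proved by transport/moment means or by downward steering only.
- Literature.Barriers.CriticalPhenomena.SlabLimitUniformControl: not engaged — no slab S_k and no k
→ ∞ limit appears; the half-space is used directly where BGN is already uniform.
- Literature.Barriers.CriticalPhenomena.TransverseCrossingsNeedNotMeet: not engaged — no two
crossings are ever glued; clusters are compared only through shared vertices (sections of ONE
cluster) and through mass transport.
- Literature.Barriers.CriticalPhenomena.SpanningClustersAboveSix: the cruxes do not assert tightness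
of spanning-cluster counts; their forms hold in the mean-field regime too (d ≥ 11: a = 2/3, q < 3, c
< 2 by KozmaNachmias2011 / ChatterjeeHanson2020), so the line does not secretly rest on
hyperscaling; only the heuristic for the sharp order of r4 used "O(1) tall pieces per box".
- Literature.Barriers.CriticalPhenomena.LongRangeDiscontinuity: the death law and the layer
structure use nearest-neighbour edges (one fresh laye

History (route lifecycle, newest last):
- 2026-08-16T03:57:41Z · AUTO-CRUX (backfill): ShadowDensityVanishes — hypotheses of the deciding theorem that nothing in the route derives are cruxes (operator:999:1085951)
- 2026-09-03T10:53:30Z · DORMANT — reconciler: no traction for 5 d (last activity statement-checked at 2026-08-29T10:21:03Z); parked, not closed — `ledger route dormant route-CriticalPhenomena-Pe (operator:999:912495)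

sub-problem: PercolationContinuityZ3 · status: dormant · opened planner-plancard-CriticalPhenomena-Percolatio-fce0a8bd-0 2026-08-15T11:42:18Z · rev 5 · ledger route-CriticalPhenomena-PercLayerChain
GENERATED by the gate from the ledger (D-0016/17). Provers cite these decls: `theorem foo : Summit.CriticalPhenomena.PercolationContinuityZ3.Theses.PercLayerChain.<Decl> := …` in Summits/CriticalPhenomena/PercolationContinuityZ3/Theorems/<Name>.lean.
-/

namespace Summit.CriticalPhenomena.PercolationContinuityZ3.Theses.PercLayerChain

open scoped BigOperators Topology Manifold Classical MeasureTheory ProbabilityTheory Matrix InnerProductSpace ComplexConjugate ContinuousMap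
open Filter Set Function TopologicalSpace MeasureTheory

attribute [summit_statement] _root_.PercolationContinuityZ3

/-- item stmt-CriticalPhenomena-5747 · crux (kind.auto-crux: conjecture-grade) · rank 0 · closed · proved by Summit.CriticalPhenomena.PercolationContinuityZ3.Theorems.PercLayerChainShadowDensityVanishes.shadowDensityVanishes_proof @ 05a6d1fb8eed (prover) · by planner
why it might fail: equivalent to the conjunct (s_t ↓ θ(p_c) by BGN; θ_t/6 ≤ s_t ≤ θ_t): it fails iff θ(p_c) > 0 on ℤ³, open since Grimmett1999 §8; it is the frame every engine bounds, not progress by itself.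
sources: BarskyGrimmettNewman1991, Grimmett1999, DuminilCopinTassionCMP2016
[target] X: s_t = P_{p_c}(y_t ↔ ∂H in H) → 0 as t → ∞ (deep points lose the wall; = the tagged
lineage of the layer chain dies a.s.; card r2 in its honest form). -/
@[route_item "route-CriticalPhenomena-PercLayerChain"]
def ShadowDensityVanishes : Prop :=
  Filter.Tendsto (fun t : ℕ => (Literature.Probability.Percolation.bondPercolation (Literature.Probability.LatticeModels.zdGraph 3) (Literature.Probability.Percolation.criticalProbI 3)).real {ω | ∃ w : Literature.Probability.LatticeModels.Site 3, w 0 = 0 ∧ ω ∈ Literature.Probability.Percolation.openConnIn {x : Literature.Probability.LatticeModels.Site 3 | 0 ≤ x 0} (Pi.single 0 (t : ℤ)) w}) Filter.atTop (nhds 0)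

-- `ShadowDensityVanishes` holds: proved by `Summit.CriticalPhenomena.PercolationContinuityZ3.Theorems.PercLayerChainShadowDensityVanishes.shadowDensityVanishes_proof` @ 05a6d1fb8eed (its module imports this route file, so no `_holds` link can be stated here).

/-- item stmt-CriticalPhenomena-17581 · crux · rank 2 · open · by planner
why it might fail: Window q < x_s/(x_s−x_h) ≈ 1.96 is scaling numerics only; heavier D_t/W tails (tall clusters pinned on O(1)–O(log t) floor contacts, isolated-contact exponent < 3) could make E[(D_t/W)^q] grow polynomially for EVERY q > 1; and if s_t decays only logarithmically X1 fails while X holds.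
sources: DengBlote2005, Cardy1996, LyonsPeres2016, BarskyGrimmettNewman1991, ChatterjeeHanson2020, Summits/CriticalPhenomena/PercolationContinuityZ3/Cruxes/ShadowDensityVanishes/SplitAssembly.lean
[crux] (strategist split of ShadowDensityVanishes, piece X1) for some q > 1 the q-th SECTION-RATIO
MOMENT of the critical wall cluster grows subpolynomially: for every b > 0 there is C_b with
E_{p_c}[(D_t/W)^q] <= C_b t^b for all t >= 1, where D_t = |C_H(0) ∩ {x0 = t}| and W = |C_H(0) ∩ ∂H|
(floor footprint, >= 1). This is SectionRatioMoment (r2) with 'bounded' weakened to 'subpolynomial':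
with any growth at all the qualitative Barsky-Grimmett-Newman theorem pi_t -> 0 no longer closes the
Hölder step, a RATE for the wall arm (piece X2 = QuantitativeBGN) is needed, and neither piece alone
bounds s_t. By q-moment transport E[(D_t/W)^q] = E[A_t^{q-1}; y_t <-> ∂H in H] with A_t the
amplification D/W of the tagged lineage's own cluster, so X1 says: the shadow s_t decays at least as
fast as the (q-1)-th conditional amplification moment of a surviving lineage grows. Reality (x_s ~
0.975 DengBlote2005, x_h ~ 0.477): growth exponent (q-1)x_s - q x_h < 0 iff q < x_s/(x_s - x_h) ~
1.96, so every q in (1, 1.9] should work with room; mean field (d >= 11): exponent 3(q-1) - 2q < 0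
for q < 3. Jump world: X1 forces pi_t >= t^{-o(1)} — consistent on its own, contradicted only
together with X2. Asse -/
@[route_item "route-CriticalPhenomena-PercLayerChain"]
def SectionMomentSubpolynomial : Prop :=
  ∃ q : ℝ, 1 < q ∧ ∀ b : ℝ, 0 < b → ∃ C : ℝ, ∀ t : ℕ, 1 ≤ t → ∫⁻ ω, ENNReal.ofReal ((({v : Literature.Probability.LatticeModels.Site 3 | v 0 = (t : ℤ) ∧ ω ∈ Literature.Probability.Percolation.openConnIn {x : Literature.Probability.LatticeModels.Site 3 | 0 ≤ x 0} 0 v}.ncard : ℝ) / ({v : Literature.Probability.LatticeModels.Site 3 | v 0 = 0 ∧ ω ∈ Literature.Probability.Percolation.openConnIn {x : Literature.Probability.LatticeModels.Site 3 | 0 ≤ x 0} 0 v}.ncard : ℝ)) ^ q) ∂(Literature.Probability.Percolation.bondPercolation (Literature.Probability.LatticeModels.zdGraph 3) (Literature.Probability.Percolation.criticalProbI 3)) ≤ ENNReal.ofReal (C * (t : ℝ) ^ b)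

/-- item stmt-CriticalPhenomena-5748 · crux · rank 2 · open · by planner
why it might fail: scaling (x_s ≈ 0.975 DengBlote2005, x_h = β/ν ≈ 0.477) gives E[(D_t/W)^q] ~ t^{q(x_s−x_h)−x_s}, bounded only for q < x_s/(x_s−x_h) ≈ 1.9 (q = 2 borderline); heavier D_t/W tails from tall clusters hanging on O(1) floor contacts (isolated-contact exponent < 3) would close the window for every q > 1.
sources: DengBlote2005, Cardy1996, BarskyGrimmettNewman1991, LyonsPeres2016
[crux] there are q > 1 and C with E_{p_c}[(D_t/W)^q] ≤ C for all t ≥ 1, where D_t = |C_H(0) ∩ {x₀ =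
t}| and W = |C_H(0) ∩ {x₀ = 0}| are the height-t and floor sections of the critical wall cluster of
the origin (card: "exclude shadow amplification", corrected from the conditional ratio — which
diverges in reality too — to the q-th moment per wall point). [difficulty: open-problem] -/
@[route_item "route-CriticalPhenomena-PercLayerChain"]
def SectionRatioMoment : Prop :=
  ∃ q C : ℝ, 1 < q ∧ ∀ t : ℕ, 1 ≤ t → ∫⁻ ω, ENNReal.ofReal ((({v : Literature.Probability.LatticeModels.Site 3 | v 0 = (t : ℤ) ∧ ω ∈ Literature.Probability.Percolation.openConnIn {x : Literature.Probability.LatticeModels.Site 3 | 0 ≤ x 0} 0 v}.ncard : ℝ) / ({v : Literature.Probability.LatticeModels.Site 3 | v 0 = 0 ∧ ω ∈ Literature.Probability.Percolation.openConnIn {x : Literature.Probability.LatticeModels.Site 3 | 0 ≤ x 0} 0 v}.ncard : ℝ)) ^ q) ∂(Literature.Probability.Percolation.bondPercolation (Literature.Probability.LatticeModels.zdGraph 3) (Literature.Probability.Percolation.criticalProbI 3)) ≤ ENNReal.ofReal C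

/-- item stmt-CriticalPhenomena-0913 · crux · rank 3 · open · by planner
why it might fail: BGN is qualitative (finite-size criterion by contradiction), no rate in print for d=3 (KozmaNitzan2024 p.2); every registered line needs an open d=3 input (e.g. subcritical surface γ₁ < 2 for the KL transfer), and multi-scale steering at p_c meets the sprinkling barrier.
sources: GrimmettPercolation1999, BarskyGrimmettNewman1991, KozmaNitzan2024, ChatterjeeHanson2020, Hutchcroft2022Triangle, DengBlote2005
[crux] r4 (C): quantitative Barsky-Grimmett-Newman. At p_c(Z^3) the boundary one-arm probability
P(C_H(0) reaches sup-distance >= r) <= C r^{-a} for SOME a > 0 (numerically a = x_s ~ 0.975,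
Deng-Blote 2005). BGN's theta_H(p_c) = 0 (proved in tree: BarskyGrimmettNewman1991_Z3_holds) is
soft, by contradiction through a finite-size criterion; a rate needs a renewal/multi-scale version
of steering. Publishable alone; wanted in spirit by cards counterfactual-cluster-resistance,
boundary-critical-squeeze, climb-ratio-receding-floor-v2, quarantine-fat-islands (which needs a >
4/5). Sources: Grimmett1999 Thm (7.35) pp.162-169; KozmaNitzan2024 p.2 item 4 (no rate for BGN in
print); doi:10.1103/PhysRevE.71.016117. -/
@[route_item "route-CriticalPhenomena-PercLayerChain"]
def QuantitativeBGN : Prop :=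
  ∃ a C : ℝ, 0 < a ∧ ∀ r : ℕ, 1 ≤ r → (Literature.Probability.Percolation.bondPercolation (Literature.Probability.LatticeModels.zdGraph 3) (Literature.Probability.Percolation.criticalProbI 3)).real {ω | ∃ y : Literature.Probability.LatticeModels.Site 3, (∃ i : Fin 3, (r : ℤ) ≤ |y i|) ∧ ω ∈ Literature.Probability.Percolation.openConnIn {x : Literature.Probability.LatticeModels.Site 3 | 0 ≤ x 0} 0 y} ≤ C * (r : ℝ) ^ (-a)

/-- item stmt-CriticalPhenomena-5749 · crux · rank 3 · open · by planner
why it might fail: false in a jump world (s_t ≥ θ* while π_t → 0 by BGN), so it needs genuinely d=3 input; nothing couples deep→wall with wall→deep beyond the union bound (overshoots by t^{0.6}); the nearest inequality of this shape, Kozma–Nitzan Conj. 1, is proved only for |A| = 2; reality forces a ≤ x_h/x_s ≈ 0.49.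
sources: BarskyGrimmettNewman1991, KozmaNitzan2024, ChatterjeeHanson2020, KozmaNachmias2011, DengBlote2005
[crux] there are a > 0 and C with s_t ≤ C · π_t^a for all t ≥ 1, where π_t = P_{p_c}(C_H(0) meets
{x₀ = t}) is the wall-to-height-t arm: the deep-to-wall connection is polynomially controlled by the
wall-to-deep connection (reality a ≤ x_h/x_s ≈ 0.49; jump world: s_t ≥ θ* while π_t → 0).
[difficulty: open-problem] -/
@[route_item "route-CriticalPhenomena-PercLayerChain"]
def ShadowReciprocity : Prop :=
  ∃ a C : ℝ, 0 < a ∧ ∀ t : ℕ, 1 ≤ t → (Literature.Probability.Percolation.bondPercolation (Literature.Probability.LatticeModels.zdGraph 3) (Literature.Probability.Percolation.criticalProbI 3)).real {ω | ∃ w : Literature.Probability.LatticeModels.Site 3, w 0 = 0 ∧ ω ∈ Literature.Probability.Percolation.openConnIn {x : Literature.Probability.LatticeModels.Site 3 | 0 ≤ x 0} (Pi.single 0 (t : ℤ)) w} ≤ C * ((Literature.Probability.Percolation.bondPercolation (Literature.Probability.LatticeModels.zdGraph 3) (Literature.Probability.Percolation.criticalProbI 3)).real {ω | ∃ y : Literature.Probability.LatticeModels.Site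 3, y 0 = (t : ℤ) ∧ ω ∈ Literature.Probability.Percolation.openConnIn {x : Literature.Probability.LatticeModels.Site 3 | 0 ≤ x 0} 0 y}) ^ a

/-- item stmt-CriticalPhenomena-5750 · crux · rank 4 · open · by planner
why it might fail: c/t is the sharp order (reality t·h_t → x_h ≈ 0.48, no slack): deep pieces hanging on O(log t) floor contacts need density ≍ t^{-3} per floor site, the 3-D analogue of the half-plane 3-arm exponent 2 = d (Nolin2008 Thm 23); any o(t^{-3}) correction kills this form while X survives.
sources: Nolin2008, Grimmett1999, BarskyGrimmettNewman1991, DuminilCopinTassionCMP2016, Literature.Barriers.CriticalPhenomena.exists_oneArmProb_criticalProbI_lower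
[crux] there is c > 0 with P_{p_c}(y_t ↔ ∂H in H and every floor point so reached has its edge to
{x₀ = −1} closed) ≥ (c/t)·s_t for all t ≥ 1 — by the death law the left side is s_t − s_{t+1}, so
this says the tagged lineage's hazard is ≥ c/t (reality: t·h_t → x_h ≈ 0.48; jump world: Σ_t h_t <
∞); it yields s_t ≤ C t^{−c}, a polynomial one-arm bound. [difficulty: open-problem] -/
@[route_item "route-CriticalPhenomena-PercLayerChain"]
def LineageHazard : Prop :=
  ∃ c : ℝ, 0 < c ∧ ∀ t : ℕ, 1 ≤ t → c / (t : ℝ) * (Literature.Probability.Percolation.bondPercolation (Literature.Probability.LatticeModels.zdGraph 3) (Literature.Probability.Percolation.criticalProbI 3)).real {ω | ∃ w : Literature.Probability.LatticeModels.Site 3, w 0 = 0 ∧ ω ∈ Literature.Probability.Percolation.openConnIn {x : Literature.Probability.LatticeModels.Site 3 | 0 ≤ x 0} (Pi.single 0 (t : ℤ)) w} ≤ (Literature.Probability.Percolation.bondPercolation (Literature.Probability.LatticeModels.zdGraph 3) (Literature.Probability.Percolation.criticalProbI 3)).real {ω | (∃ w : Literature.Probability.LatticeModels.Site 3, w 0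 = 0 ∧ ω ∈ Literature.Probability.Percolation.openConnIn {x : Literature.Probability.LatticeModels.Site 3 | 0 ≤ x 0} (Pi.single 0 (t : ℤ)) w) ∧ ∀ w : Literature.Probability.LatticeModels.Site 3, w 0 = 0 → ω ∈ Literature.Probability.Percolation.openConnIn {x : Literature.Probability.LatticeModels.Site 3 | 0 ≤ x 0} (Pi.single 0 (t : ℤ)) w → s(w, w - Pi.single 0 1) ∉ ω}

/-- item stmt-CriticalPhenomena-17629 · support · rank 9 · closed · proved by Summit.CriticalPhenomena.PercolationContinuityZ3.Theorems.splitGlue_proof @ 7a013c9e8476 (prover) · by planner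
[support] (strategist split glue) SectionMomentSubpolynomial → QuantitativeBGN →
ShadowDensityVanishes: Hölder on the shadow transport identity s_t = E[(D_t/W)·1{D_t ≥ 1}]
(ShadowTransport, proved) with exponents q, (1−1/q)⁻¹ (lintegral_ratio_le_holder of
Theorems/PercLayerChainMomentGivesReciprocity.lean), π_t ≤ π_s(t) ≤ C t^{-a}, b := a(q−1)/2, hence
s_t ≤ K t^{-a(q−1)/(2q)} → 0. PROVED sorry-free: theorem shadowDensityVanishes_of_subs in
Summits/CriticalPhenomena/PercolationContinuityZ3/Cruxes/ShadowDensityVanishes/SplitAssembly.lean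
(lean check rc0, ~210 lines; evidence on stmt-CriticalPhenomena-5747). A prover lands that file
verbatim as Theorems/PercLayerChainShadowDensityVanishesSplit.lean and closes this item with
`theorem splitGlue_proof : SplitGlue := fun h1 h2 => shadowDensityVanishes_of_subs h1 h2`
(PercLayerChain.QuantitativeBGN and PercLowPointHalfSpace.QuantitativeBGN have the same body; defeq
by delta). [difficulty: provable-now] SOURCES: LyonsPeres2016, BarskyGrimmettNewman1991,
GrimmettPercolation1999 -/
@[route_item "route-CriticalPhenomena-PercLayerChain"]
def SplitGlue : Prop :=
  SectionMomentSubpolynomial → QuantitativeBGN → ShadowDensityVanishes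

-- `SplitGlue` holds: proved by `Summit.CriticalPhenomena.PercolationContinuityZ3.Theorems.splitGlue_proof` @ 7a013c9e8476 (its module imports this route file, so no `_holds` link can be stated here).

/-- item stmt-CriticalPhenomena-5751 · support · rank 9 · closed · proved by Summit.CriticalPhenomena.PercolationContinuityZ3.Theorems.shadowTransport_proof @ 6ef6a0f673af (prover) · by planner
sources: LyonsPeres2016, BarskyGrimmettNewman1991
[support] footprint-normalised mass transport: for every t, s_t = E_{p_c}[D_t / W] (send mass 1/W
from each floor point of a wall cluster to each of its height-t points; horizontal translation
invariance bondPercolation_map_shift + shift_mem_openConnIn_iff; C_H(0) a.s. finite by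
BarskyGrimmettNewman1991_Z3_holds handles the conventions on the null set). [difficulty:
provable-now] -/
@[route_item "route-CriticalPhenomena-PercLayerChain"]
def ShadowTransport : Prop :=
  ∀ t : ℕ, ∫⁻ ω, ENNReal.ofReal (({v : Literature.Probability.LatticeModels.Site 3 | v 0 = (t : ℤ) ∧ ω ∈ Literature.Probability.Percolation.openConnIn {x : Literature.Probability.LatticeModels.Site 3 | 0 ≤ x 0} 0 v}.ncard : ℝ) / ({v : Literature.Probability.LatticeModels.Site 3 | v 0 = 0 ∧ ω ∈ Literature.Probability.Percolation.openConnIn {x : Literature.Probability.LatticeModels.Site 3 | 0 ≤ x 0} 0 v}.ncard : ℝ)) ∂(Literature.Probability.Percolation.bondPercolation (Literature.Probability.LatticeModels.zdGraph 3) (Literature.Probability.Percolation.criticalProbI 3)) = ENNReal.ofReal ((Literature.Probability.Percolation.bondPercolation (Literature.Probability.LatticeModels.zdGraph 3) (Literature.Probability.Percolation.criticalProbI 3)).real {ω | ∃ w : Literature.Probability.LatticeModels.Site 3, w 0 = 0 ∧ ω ∈ Literature.Probability.Percolation.openConnIn {x : Literature.Probability.LatticeModels.Site 3 | 0 ≤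 x 0} (Pi.single 0 (t : ℤ)) w})

-- `ShadowTransport` holds: proved by `Summit.CriticalPhenomena.PercolationContinuityZ3.Theorems.shadowTransport_proof` @ 6ef6a0f673af (its module imports this route file, so no `_holds` link can be stated here).

/-- item stmt-CriticalPhenomena-5752 · support · rank 9 · closed · proved by Summit.CriticalPhenomena.PercolationContinuityZ3.Theorems.DeathLaw_proof @ a8d437295be2 (prover) · by planner
sources: Grimmett1999, BarskyGrimmettNewman1991
[support] the exact death law of the layer chain in fixed-H form: s_t − s_{t+1} = P(y_t ↔ ∂H in H,
and no floor point joined to y_t in H has an open edge to {x₀ = −1}) (vertical shift by one layer +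
first-passage decomposition of a path at the floor; by independence of the sub-floor edges the right
side equals E[(1−p_c)^{|B_t|}; B_t ≠ ∅], B_t the floor block of y_t). [difficulty: provable-now] -/
@[route_item "route-CriticalPhenomena-PercLayerChain"]
def DeathLaw : Prop :=
  ∀ t : ℕ, (Literature.Probability.Percolation.bondPercolation (Literature.Probability.LatticeModels.zdGraph 3) (Literature.Probability.Percolation.criticalProbI 3)).real {ω | ∃ w : Literature.Probability.LatticeModels.Site 3, w 0 = 0 ∧ ω ∈ Literature.Probability.Percolation.openConnIn {x : Literature.Probability.LatticeModels.Site 3 | 0 ≤ x 0} (Pi.single 0 (t : ℤ)) w} - (Literature.Probability.Percolation.bondPercolation (Literature.Probability.LatticeModels.zdGraph 3) (Literature.Probability.Percolation.criticalProbI 3)).real {ω | ∃ w : Literature.Probability.LatticeModels.Site 3, w 0 = 0 ∧ ω ∈ Literature.Probability.Percolation.openConnIn {x : Literature.Probability.LatticeModels.Site 3 | 0 ≤ x 0} (Pi.single 0 ((t + 1 : ℕ) : ℤ)) w} = (Literature.Probability.Percolation.bondPercolation (Literature.Probability.LatticeModels.zdGraph 3) (Literature.Probability.Percolation.criticalProbI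 3)).real {ω | (∃ w : Literature.Probability.LatticeModels.Site 3, w 0 = 0 ∧ ω ∈ Literature.Probability.Percolation.openConnIn {x : Literature.Probability.LatticeModels.Site 3 | 0 ≤ x 0} (Pi.single 0 (t : ℤ)) w) ∧ ∀ w : Literature.Probability.LatticeModels.Site 3, w 0 = 0 → ω ∈ Literature.Probability.Percolation.openConnIn {x : Literature.Probability.LatticeModels.Site 3 | 0 ≤ x 0} (Pi.single 0 (t : ℤ)) w → s(w, w - Pi.single 0 1) ∉ ω}

-- `DeathLaw` holds: proved by `Summit.CriticalPhenomena.PercolationContinuityZ3.Theorems.DeathLaw_proof` @ a8d437295be2 (its module imports this route file, so no `_holds` link can be stated here).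

/-- item stmt-CriticalPhenomena-5753 · support · rank 9 · closed · proved by Summit.CriticalPhenomena.PercolationContinuityZ3.Theorems.momentGivesReciprocity_proof @ 6c70fe169b17 (prover) · by planner
sources: LyonsPeres2016, BarskyGrimmettNewman1991
[support] SectionRatioMoment → ShadowReciprocity with a = 1 − 1/q: Hölder on s_t = E[(D_t/W)·1{D_t ≥
1}] (ShadowTransport) and π_t = P(D_t ≥ 1). [difficulty: provable-now] -/
@[route_item "route-CriticalPhenomena-PercLayerChain"]
def MomentGivesReciprocity : Prop :=
  SectionRatioMoment → ShadowReciprocity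

-- `MomentGivesReciprocity` holds: proved by `Summit.CriticalPhenomena.PercolationContinuityZ3.Theorems.momentGivesReciprocity_proof` @ 6c70fe169b17 (its module imports this route file, so no `_holds` link can be stated here).

/-- item stmt-CriticalPhenomena-5754 · support · rank 9 · closed · proved by Summit.CriticalPhenomena.PercolationContinuityZ3.Theorems.reciprocitySuffices_proof (prover) · by planner
sources: BarskyGrimmettNewman1991, Grimmett1999
[support] ShadowReciprocity → ShadowDensityVanishes: π_t ↓ P(C_H(0) infinite) = 0 (events decreasing
in t; BarskyGrimmettNewman1991_Z3_holds via theta_induce_eq_real_percolatesVia), hence s_t ≤ C π_t^a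
→ 0. [difficulty: provable-now] -/
@[route_item "route-CriticalPhenomena-PercLayerChain"]
def ReciprocitySuffices : Prop :=
  ShadowReciprocity → ShadowDensityVanishes

-- `ReciprocitySuffices` holds: proved by `Summit.CriticalPhenomena.PercolationContinuityZ3.Theorems.reciprocitySuffices_proof` (its module imports this route file, so no `_holds` link can be stated here).

/-- item stmt-CriticalPhenomena-5755 · support · rank 9 · closed · proved by Summit.CriticalPhenomena.PercolationContinuityZ3.Theorems.hazardSuffices_proof @ f42349d5b6d8 (prover) · by planner
sources: Grimmett1999
[support] LineageHazard → ShadowDensityVanishes: with DeathLaw, s_{t+1} ≤ (1 − c/t) s_t for t ≥ 1,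
so s_t ≤ s_1 ∏_{j<t}(1 − c/j) → 0. [difficulty: M] -/
@[route_item "route-CriticalPhenomena-PercLayerChain"]
def HazardSuffices : Prop :=
  LineageHazard → ShadowDensityVanishes

-- `HazardSuffices` holds: proved by `Summit.CriticalPhenomena.PercolationContinuityZ3.Theorems.hazardSuffices_proof` @ f42349d5b6d8 (its module imports this route file, so no `_holds` link can be stated here).

/-- item stmt-CriticalPhenomena-5756 · support · rank 9 · closed · proved by Summit.CriticalPhenomena.PercolationContinuityZ3.Theorems.tightnessCriterion_proof @ ef4152cfb493 (prover) · by planner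
sources: BarskyGrimmettNewman1991, Grimmett1999
[support] the card's criterion: if the floor block B_t = {w ∈ ∂H : y_t ↔ w in H} is tight uniformly
in t (∀ε ∃m ∀t P(|B_t| ≥ m) ≤ ε, |·| = encard), then θ(p_c) = 0. Proof: DeathLaw summed over t gives
Σ_t E[(1−p_c)^{|B_t|}; 1 ≤ |B_t| < ∞] ≤ 1, so P(1 ≤ |B_t| ≤ m) → 0 for each m; hence limsup s_t ≤ ε,
i.e. X, then Assembly. [difficulty: M] -/
@[route_item "route-CriticalPhenomena-PercLayerChain"]
def TightnessCriterion : Prop :=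
  (∀ ε : ℝ, 0 < ε → ∃ m : ℕ, ∀ t : ℕ, (Literature.Probability.Percolation.bondPercolation (Literature.Probability.LatticeModels.zdGraph 3) (Literature.Probability.Percolation.criticalProbI 3)).real {ω | (m : ℕ∞) ≤ {w : Literature.Probability.LatticeModels.Site 3 | w 0 = 0 ∧ ω ∈ Literature.Probability.Percolation.openConnIn {x : Literature.Probability.LatticeModels.Site 3 | 0 ≤ x 0} (Pi.single 0 (t : ℤ)) w}.encard} ≤ ε) → PercolationContinuityZ3

-- `TightnessCriterion` holds: proved by `Summit.CriticalPhenomena.PercolationContinuityZ3.Theorems.tightnessCriterion_proof` @ ef4152cfb493 (its module imports this route file, so no `_holds` link can be stated here).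

/-- item stmt-CriticalPhenomena-5757 · assembly · rank 1 · closed · proved by Summit.CriticalPhenomena.PercolationContinuityZ3.Theorems.percLayerChainAssembly_proof @ 0db945e77d03 (prover) · by planner
sources: BarskyGrimmettNewman1991, Grimmett1999, DuminilCopinTassionCMP2016
[assembly] ShadowDensityVanishes → PercolationContinuityZ3 (square-root trick over the six faces of
a floor-standing cube, or BGN + vertical shift). -/
@[route_item "route-CriticalPhenomena-PercLayerChain"]
def Assembly : Prop :=
  ShadowDensityVanishes → PercolationContinuityZ3

-- `Assembly` holds: proved by `Summit.CriticalPhenomena.PercolationContinuityZ3.Theorems.percLayerChainAssembly_proof` @ 0db945e77d03 (its module imports this route file, so no `_holds` link can be stated here).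

/-! D-0027 §2.1 — DECIDING THEOREM (planner-authored via `route open/edit --closes-file`; by planner-cstrat-stmt-CriticalPhenomena-5747-r1-0 2026-08-17T02:06:20Z):
its hypotheses are this route's items and its conclusion the sub-problem Statement (glue_lint), and it elaborates with this file. -/

@[closes "route-CriticalPhenomena-PercLayerChain"] theorem closes (h₁ : SectionMomentSubpolynomial) (h₂ : QuantitativeBGN) (hG : SplitGlue)
    (hA : Assembly) : _root_.PercolationContinuityZ3 :=
  hA (hG h₁ h₂)

end Summit.CriticalPhenomena.PercolationContinuityZ3.Theses.PercLayerChain
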